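import Literature.Dynamics.Hyperbolic.SequenceShadowingExistence

/-!
# Shadowing for a sequence of maps of a Banach space, IV: uniqueness and periodic shadows

Under Pilyugin's conditions (a), (b) AND the forward invariance / expansion of the unstable part
(condition (b') of his Theorem 1.3.2: `A_k U_k ⊆ U_{k+1}`, `‖A_k v‖ ≥ λ⁻¹ ‖v‖` on `U_k`) the linear
recursion `u_{k+1} = A_k u_k` has no non-zero bounded solution on `ℤ` (exponential dichotomy,
`eq_zero_of_bounded_linear`); hence every trajectory of `φ` in the `Δ`-ball is the fixed point of
`𝒢 w̄` (`eq_green_of_trajectory`) and the shadowing trajectory of Theorem 1.3.1 is UNIQUE among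
trajectories in the `Δ`-ball (`shadow_unique` — a variant of S. Yu. Pilyugin, LNM 1706 (1999), Thm 1.3.2,
which instead of (b) uses the cone inequalities (1.69)).  Consequently, for maps `p`-PERIODIC in `k` the
shadow is `p`-periodic (`exists_periodic_shadow`): the closing mechanism behind Anosov's and Katok's
closing lemmas once a returning orbit segment has been written as a periodic hyperbolic sequence in charts.
Fully proved.

## References

* S. Yu. Pilyugin, *Shadowing in Dynamical Systems*, LNM 1706 (1999), §1.3.2, Theorem 1.3.2. [Pilyugin1999]
-/

noncomputable section

open Filter Set Function
open scoped Topology NNReal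

namespace Literature.Dynamics.Hyperbolic

variable {E : Type*} [NormedAddCommGroup E] [NormedSpace ℝ E]

namespace IsHyperbolicSequence

variable {A P B : ℤ → E →L[ℝ] E} {lam N : ℝ}

/-- `P_j x = x` on `S_j` (idempotence). [folklore] -/
theorem P_apply_of_mem_stable (h : IsHyperbolicSequence A P B lam N) {j : ℤ} {x : E}
    (hx : x ∈ stableSpace P j) : P j x = x := by
  obtain ⟨w, rfl⟩ := mem_stableSpace.1 hx
  exact h.proj_idem j w

/-- `P_j y = 0` on `U_j` (idempotence). [folklore] -/
theorem P_apply_of_mem_unstable (h : IsHyperbolicSequence A P B lam N) {j : ℤ} {y : E}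
    (hy : y ∈ unstableSpace P j) : P j y = 0 := by
  obtain ⟨w, rfl⟩ := mem_unstableSpace.1 hy
  rw [show ((1 : E →L[ℝ] E) - P j) w = (1 : E →L[ℝ] E) w - P j w from rfl, one_apply_eq_self, map_sub,
    h.proj_idem, sub_self]

/-- UNIQUE DECOMPOSITION along `E = S_j ⊕ U_j`: `a + b = a' + b'` with `a, a' ∈ S_j`, `b, b' ∈ U_j` forces
`a = a'` and `b = b'`. [folklore] -/
theorem decomp_unique (h : IsHyperbolicSequence A P B lam N) {j : ℤ} {a a' b b' : E}
    (ha : a ∈ stableSpace P j) (ha' : a' ∈ stableSpace P j) (hb : b ∈ unstableSpace P j)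
    (hb' : b' ∈ unstableSpace P j) (he : a + b = a' + b') : a = a' ∧ b = b' := by
  have h1 : P j (a + b) = P j (a' + b') := by rw [he]
  rw [map_add, map_add, h.P_apply_of_mem_stable ha, h.P_apply_of_mem_stable ha',
    h.P_apply_of_mem_unstable hb, h.P_apply_of_mem_unstable hb', add_zero, add_zero] at h1
  refine ⟨h1, ?_⟩
  rw [h1] at he
  exact add_left_cancel he

omit [NormedSpace ℝ E] in
/-- A vector dominated by all terms of a convergent geometric progression vanishes. [folklore] -/
theorem _root_.Literature.Dynamics.Hyperbolic.eq_zero_of_norm_le_geom {x : E} {r M : ℝ} (hr0 : 0 ≤ r) (hr1 : r < 1)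
    (hx : ∀ m : ℕ, ‖x‖ ≤ r ^ m * M) : x = 0 := by
  have ht : Tendsto (fun m : ℕ => r ^ m * M) atTop (𝓝 (0 * M)) :=
    (tendsto_pow_atTop_nhds_zero_of_lt_one hr0 hr1).mul_const M
  rw [zero_mul] at ht
  exact norm_le_zero_iff.1 (ge_of_tendsto' ht hx)

/-- **EXPONENTIAL DICHOTOMY ⇒ no bounded homogeneous solutions.**  Under (a), (b') the linear recursion
`u_{k+1} = A_k u_k` (`k ∈ ℤ`) has only the zero bounded solution. [folklore] -/
theorem eq_zero_of_bounded_linear (h : IsHyperbolicSequence A P B lam N)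
    (hU : ∀ (k : ℤ), ∀ v ∈ unstableSpace P k, A k v ∈ unstableSpace P (k + 1))
    (hexp : ∀ (k : ℤ), ∀ v ∈ unstableSpace P k, ‖v‖ ≤ lam * ‖A k v‖)
    {u : ℤ → E} {C : ℝ} (hC : ∀ k, ‖u k‖ ≤ C) (hrec : ∀ k, u (k + 1) = A k (u k)) : ∀ k, u k = 0 := by
  -- stable / unstable components and their recursions
  set s : ℤ → E := fun k => P k (u k) with hs
  set t : ℤ → E := fun k => ((1 : E →L[ℝ] E) - P k) (u k) with htdef
  have hsmem : ∀ k, s k ∈ stableSpace P k := fun k => apply_mem_stableSpace P k (u k)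
  have htmem : ∀ k, t k ∈ unstableSpace P k := fun k => apply_mem_unstableSpace P k (u k)
  have hsum : ∀ k, s k + t k = u k := fun k => by
    simp only [hs, htdef]
    rw [show ((1 : E →L[ℝ] E) - P k) (u k) = (1 : E →L[ℝ] E) (u k) - P k (u k) from rfl, one_apply_eq_self]
    abel
  have hstep : ∀ k, s (k + 1) = A k (s k) ∧ t (k + 1) = A k (t k) := by
    intro k
    apply h.decomp_unique (hsmem (k + 1)) (h.mapsTo_stable k _ (hsmem k)) (htmem (k + 1)) (hU k _ (htmem k))
    rw [hsum, ← map_add, hsum, hrec]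
  have hsb : ∀ k, ‖s k‖ ≤ N * C := fun k => (h.norm_P_apply_le k (u k)).trans (mul_le_mul_of_nonneg_left (hC k) h.N_nonneg)
  have htb : ∀ k, ‖t k‖ ≤ N * C := fun k => (h.norm_Q_apply_le k (u k)).trans (mul_le_mul_of_nonneg_left (hC k) h.N_nonneg)
  -- unstable component: `‖t k‖ ≤ λ^m ‖t (k+m)‖ ≤ λ^m N C`
  have ht_it : ∀ (m : ℕ) (k : ℤ), ‖t k‖ ≤ lam ^ m * ‖t (k + m)‖ := by
    intro m
    induction m with
    | zero => intro k; simp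
    | succ m ih =>
      intro k
      have h1 : ‖t k‖ ≤ lam * ‖t (k + 1)‖ := by rw [(hstep k).2]; exact hexp k _ (htmem k)
      have h2 := ih (k + 1)
      have h3 : k + 1 + (m : ℤ) = k + ((m + 1 : ℕ) : ℤ) := by push_cast; ring
      rw [h3] at h2
      calc ‖t k‖ ≤ lam * ‖t (k + 1)‖ := h1
        _ ≤ lam * (lam ^ m * ‖t (k + ((m + 1 : ℕ) : ℤ))‖) := mul_le_mul_of_nonneg_left h2 h.lam_nonneg
        _ = lam ^ (m + 1) * ‖t (k + ((m + 1 : ℕ) : ℤ))‖ := by ring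
  have ht0 : ∀ k, t k = 0 := fun k =>
    eq_zero_of_norm_le_geom h.lam_nonneg h.lam_lt_one fun m => (ht_it m k).trans (mul_le_mul_of_nonneg_left (htb _) (pow_nonneg h.lam_nonneg _))
  -- stable component: `‖s k‖ ≤ λ^m ‖s (k-m)‖ ≤ λ^m N C`
  have hs_it : ∀ (m : ℕ) (k : ℤ), ‖s k‖ ≤ lam ^ m * ‖s (k - m)‖ := by
    intro m
    induction m with
    | zero => intro k; simp
    | succ m ih =>
      intro k
      have h3 : k - ((m + 1 : ℕ) : ℤ) + 1 = k - (m : ℤ) := by push_cast; ring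
      have h1 : ‖s (k - m)‖ ≤ lam * ‖s (k - ((m + 1 : ℕ) : ℤ))‖ := by
        rw [← h3, (hstep _).1]; exact h.contract _ _ (hsmem _)
      calc ‖s k‖ ≤ lam ^ m * ‖s (k - m)‖ := ih k
        _ ≤ lam ^ m * (lam * ‖s (k - ((m + 1 : ℕ) : ℤ))‖) := mul_le_mul_of_nonneg_left h1 (pow_nonneg h.lam_nonneg _)
        _ = lam ^ (m + 1) * ‖s (k - ((m + 1 : ℕ) : ℤ))‖ := by ring
  have hs0 : ∀ k, s k = 0 := fun k =>
    eq_zero_of_norm_le_geom h.lam_nonneg h.lam_lt_one fun m => (hs_it m k).trans (mul_le_mul_of_nonneg_left (hsb _) (pow_nonneg h.lam_nonneg _))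
  intro k
  rw [← hsum k, hs0, ht0, add_zero]

/-- Size of the nonlinearity on the `Δ`-ball: `‖φ_k(x) - A_k x‖ ≤ d + κΔ` for `‖x‖ ≤ Δ`. [folklore] -/
theorem _root_.Literature.Dynamics.Hyperbolic.norm_nonlin_le {A : ℤ → E →L[ℝ] E} {φ : ℤ → E → E} {κ Δ d : ℝ}
    (hκ : 0 ≤ κ)
    (hLip : ∀ (k : ℤ) (v v' : E), ‖v‖ ≤ Δ → ‖v'‖ ≤ Δ →
      ‖(φ k v - A k v) - (φ k v' - A k v')‖ ≤ κ * ‖v - v'‖)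
    (hφ0 : ∀ k, ‖φ k 0‖ ≤ d) (k : ℤ) {x : E} (hx : ‖x‖ ≤ Δ) : ‖φ k x - A k x‖ ≤ d + κ * Δ := by
  have hΔ : 0 ≤ Δ := (norm_nonneg _).trans hx
  have h1 := hLip k x 0 hx (by simpa using hΔ)
  simp only [map_zero, sub_zero] at h1
  calc ‖φ k x - A k x‖ = ‖(φ k x - A k x - φ k 0) + φ k 0‖ := by simp only [sub_add_cancel]
    _ ≤ ‖φ k x - A k x - φ k 0‖ + ‖φ k 0‖ := norm_add_le _ _
    _ ≤ κ * ‖x‖ + d := add_le_add h1 (hφ0 _)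
    _ ≤ κ * Δ + d := by gcongr
    _ = d + κ * Δ := by ring

variable [CompleteSpace E]

/-- **Every trajectory in the `Δ`-ball is the fixed point of `𝒢 w̄`**: if `φ_k(v_k) = v_{k+1}`,
`‖v_k‖ ≤ Δ`, then `v_n = (𝒢 w̄(v))_n` with `w̄(v)_k = φ_{k-1}(v_{k-1}) - A_{k-1}v_{k-1}`. [folklore] -/
theorem eq_green_of_trajectory (h : IsHyperbolicSequence A P B lam N)
    (hU : ∀ (k : ℤ), ∀ v ∈ unstableSpace P k, A k v ∈ unstableSpace P (k + 1))
    (hexp : ∀ (k : ℤ), ∀ v ∈ unstableSpace P k, ‖v‖ ≤ lam * ‖A k v‖)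
    {φ : ℤ → E → E} {κ Δ d : ℝ} (hκ : 0 ≤ κ)
    (hLip : ∀ (k : ℤ) (v v' : E), ‖v‖ ≤ Δ → ‖v'‖ ≤ Δ →
      ‖(φ k v - A k v) - (φ k v' - A k v')‖ ≤ κ * ‖v - v'‖)
    (hφ0 : ∀ k, ‖φ k 0‖ ≤ d) {v : ℤ → E} (hv : ∀ k, ‖v k‖ ≤ Δ) (htraj : ∀ k, φ k (v k) = v (k + 1)) :
    ∀ n, v n = green A P B (fun k => φ (k - 1) (v (k - 1)) - A (k - 1) (v (k - 1))) n := by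
  set g : ℤ → E := fun k => φ (k - 1) (v (k - 1)) - A (k - 1) (v (k - 1)) with hg
  have hgb : ∀ k, ‖g k‖ ≤ d + κ * Δ := fun k => norm_nonlin_le hκ hLip hφ0 (k - 1) (hv _)
  -- `u = v - 𝒢 g` is a bounded homogeneous solution, hence zero
  have hGb : ∀ k, ‖green A P B g k‖ ≤ greenBound lam N * (d + κ * Δ) := fun k => h.norm_green_le hgb k
  have hub : ∀ k, ‖v k - green A P B g k‖ ≤ Δ + greenBound lam N * (d + κ * Δ) := fun k =>
    (norm_sub_le _ _).trans (add_le_add (hv k) (hGb k))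
  have hurec : ∀ k, v (k + 1) - green A P B g (k + 1) = A k (v k - green A P B g k) := by
    intro k
    rw [map_sub, h.A_green hgb k]
    have : g (k + 1) = φ k (v k) - A k (v k) := by simp only [hg, add_sub_cancel_right]
    rw [this, ← htraj k]
    abel
  have hu0 := h.eq_zero_of_bounded_linear hU hexp hub hurec
  intro n
  exact sub_eq_zero.1 (hu0 n)

/-- **Uniqueness of the shadowing trajectory in the `Δ`-ball** (cf. Pilyugin's Theorem 1.3.2; here under
conditions (a), (b), (b') and `κ N₁ < 1`, via the exponential dichotomy): two trajectories of `φ` all of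
whose terms have norm `≤ Δ` coincide. [cite: Pilyugin1999, Thm 1.3.2 (variant under (b), (b'))] -/
theorem shadow_unique (h : IsHyperbolicSequence A P B lam N)
    (hU : ∀ (k : ℤ), ∀ v ∈ unstableSpace P k, A k v ∈ unstableSpace P (k + 1))
    (hexp : ∀ (k : ℤ), ∀ v ∈ unstableSpace P k, ‖v‖ ≤ lam * ‖A k v‖)
    {φ : ℤ → E → E} {κ Δ d : ℝ} (hκ : 0 ≤ κ) (hκN : κ * greenBound lam N < 1)
    (hLip : ∀ (k : ℤ) (v v' : E), ‖v‖ ≤ Δ → ‖v'‖ ≤ Δ →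
      ‖(φ k v - A k v) - (φ k v' - A k v')‖ ≤ κ * ‖v - v'‖)
    (hφ0 : ∀ k, ‖φ k 0‖ ≤ d) {v v' : ℤ → E} (hv : ∀ k, ‖v k‖ ≤ Δ) (hv' : ∀ k, ‖v' k‖ ≤ Δ)
    (htraj : ∀ k, φ k (v k) = v (k + 1)) (htraj' : ∀ k, φ k (v' k) = v' (k + 1)) : v = v' := by
  have hΔ : 0 ≤ Δ := (norm_nonneg _).trans (hv 0)
  have hvG := h.eq_green_of_trajectory hU hexp hκ hLip hφ0 hv htraj
  have hvG' := h.eq_green_of_trajectory hU hexp hκ hLip hφ0 hv' htraj'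
  set g : ℤ → E := fun k => φ (k - 1) (v (k - 1)) - A (k - 1) (v (k - 1)) with hg
  set g' : ℤ → E := fun k => φ (k - 1) (v' (k - 1)) - A (k - 1) (v' (k - 1)) with hg'
  have hgb : ∀ k, ‖g k‖ ≤ d + κ * Δ := fun k => norm_nonlin_le hκ hLip hφ0 (k - 1) (hv _)
  have hgb' : ∀ k, ‖g' k‖ ≤ d + κ * Δ := fun k => norm_nonlin_le hκ hLip hφ0 (k - 1) (hv' _)
  -- one contraction step on the sup-distance
  have hdiff : ∀ M : ℝ, (∀ k, ‖v k - v' k‖ ≤ M) → ∀ k, ‖v k - v' k‖ ≤ κ * greenBound lam N * M := by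
    intro M hM k
    have hgd : ∀ j, ‖g j - g' j‖ ≤ κ * M := fun j =>
      (hLip (j - 1) _ _ (hv _) (hv' _)).trans (mul_le_mul_of_nonneg_left (hM _) hκ)
    rw [hvG k, hvG' k, ← h.green_sub hgb hgb' k]
    calc ‖green A P B (fun j => g j - g' j) k‖ ≤ greenBound lam N * (κ * M) := h.norm_green_le hgd k
      _ = κ * greenBound lam N * M := by ring
  -- iterate: `‖v_k - v'_k‖ ≤ (κN₁)^j · 2Δ → 0`
  have hit : ∀ (j : ℕ) (k : ℤ), ‖v k - v' k‖ ≤ (κ * greenBound lam N) ^ j * (2 * Δ) := by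
    intro j
    induction j with
    | zero =>
      intro k
      have := (norm_sub_le (v k) (v' k)).trans (add_le_add (hv k) (hv' k))
      simpa [two_mul] using this
    | succ j ih =>
      intro k
      calc ‖v k - v' k‖ ≤ κ * greenBound lam N * ((κ * greenBound lam N) ^ j * (2 * Δ)) := hdiff _ ih k
        _ = (κ * greenBound lam N) ^ (j + 1) * (2 * Δ) := by ring
  funext k
  exact sub_eq_zero.1 (eq_zero_of_norm_le_geom (mul_nonneg hκ h.greenBound_pos.le) hκN fun j => hit j k)

/-- **PERIODIC SHADOWS (the closing mechanism).**  Under the hypotheses of Theorem 1.3.1 together with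
(b'), if the maps are `p`-periodic in `k` (`φ_{k+p} = φ_k`), the shadowing trajectory is `p`-periodic:
its shift by `p` is again a trajectory in the `LΔ`… `Ld`-ball, and trajectories in the `Δ`-ball are unique. [folklore] -/
theorem exists_periodic_shadow (h : IsHyperbolicSequence A P B lam N)
    (hU : ∀ (k : ℤ), ∀ v ∈ unstableSpace P k, A k v ∈ unstableSpace P (k + 1))
    (hexp : ∀ (k : ℤ), ∀ v ∈ unstableSpace P k, ‖v‖ ≤ lam * ‖A k v‖)
    {φ : ℤ → E → E} {κ Δ d : ℝ} (hκ : 0 ≤ κ) (hd : 0 ≤ d) (hκN : κ * greenBound lam N < 1)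
    (hLip : ∀ (k : ℤ) (v v' : E), ‖v‖ ≤ Δ → ‖v'‖ ≤ Δ →
      ‖(φ k v - A k v) - (φ k v' - A k v')‖ ≤ κ * ‖v - v'‖)
    (hφ0 : ∀ k, ‖φ k 0‖ ≤ d) (hdΔ : d ≤ Δ / shadowConst lam N κ) {p : ℕ} (hper : ∀ k : ℤ, φ (k + p) = φ k) :
    ∃ v : ℤ → E, (∀ k, ‖v k‖ ≤ shadowConst lam N κ * d) ∧ (∀ k, φ k (v k) = v (k + 1)) ∧
      ∀ k, v (k + p) = v k := by
  obtain ⟨v, hb, ht⟩ := h.exists_shadow hκ hd hκN hLip hφ0 hdΔ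
  have hLpos : 0 < shadowConst lam N κ := div_pos h.greenBound_pos (sub_pos.2 hκN)
  have hLd : shadowConst lam N κ * d ≤ Δ := by rwa [le_div_iff₀ hLpos, mul_comm] at hdΔ
  have hvΔ : ∀ k, ‖v k‖ ≤ Δ := fun k => (hb k).trans hLd
  have ht' : ∀ k, φ k (v (k + p)) = v (k + 1 + p) := by
    intro k
    rw [← hper k, ht (k + p)]
    congr 1; ring
  have heq := h.shadow_unique hU hexp hκ hκN hLip hφ0 (fun k => hvΔ (k + p)) hvΔ ht' ht
  exact ⟨v, hb, ht, fun k => congrFun heq k⟩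

end IsHyperbolicSequence

end Literature.Dynamics.Hyperbolic

end
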